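import Mathlib
import Summits.QuantumFields.QCD.Theses.PauliWegnerSea
import Summits.QuantumFields.QCD.Theorems.PauliWegnerSeaPhaseQuenchedFlavourDecayUniformPencilOfCrux
import Summits.QuantumFields.QCD.Theorems.PauliWegnerSeaPhaseQuenchedFlavourDecayPionSecondMomentOfCrux

/-!
# Stub `stub_uniformPionSecondMoment_of_crux` of line `crossing-split-integrability`
(crux `Summit.QuantumFields.QCD.Theses.PauliWegnerSea.PhaseQuenchedFlavourDecay`, item stmt-QuantumFields-9151)

**NECESSITY made `(s, C)`-uniform: the crux forces the volume- and parameter-uniform exponential decay of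
the phase-quenched PION SECOND MOMENT.**  For renormalised masses `m > 0`, a mass-degenerate doublet
`f ≠ g` (`m f = m g`) and Fredenhagen–Marcu data `(s, C)` there are an amplitude `Φ`, a rate ratio
`θ > 0` and thresholds `μ₀ > 0`, `Λ₀` such that at EVERY lattice parameter point `(β, c, λ > 0)` (bare
masses `c + λ m`), every rate `0 < μ ≤ μ₀` and every `L` with `μ L ≥ Λ₀`: Fredenhagen–Marcu decay
`FM ≤ C e^{-μ ‖v‖}` on the volumes `S ≥ L` gives
`⟨Σ_{a,i,b,j} |G_f((0,a,i),(n e₀,b,j))|²⟩₊ ≤ Φ e^{-θ μ n}` on those volumes (`n ≤ S`).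

Proof (pure bookkeeping over landed facts):
* the crux implies its reg-free UNIFORM pencil form `stub_uniformPencil_of_crux`
  (`…UniformPencilOfCrux.lean`): a rate `θ` and, for every flavour-charged pair `(A, B)`, uniform
  constants `(Φ, μ₀, Λ₀)` bounding the modulus of the complex phase-quenched correlator of `A(0)`,
  `B(n e₀)` by `Φ e^{-θ μ n}`;
* apply it to the flavoured pseudoscalar pair `A = ψ̄_g γ₅ ψ_f` (`pseudoscalarDensityObs Nf (Matrix.single g f 1)`,
  `U(1)_f` charge `+1`, `isFlavourCharged_pseudoscalarDensityObs_single`) and `B = ψ̄_f γ₅ ψ_g`;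
* in every gauge background the Wick contraction of this pair at degenerate masses is MINUS the
  colour–spin sum of squared moduli of the flavour-`f` propagator (`pionPair_fermiRatio_eq`,
  `pseudoscalarDensityObs_single_onTorus`), so the complex quotient is `−(⟨X⟩₊ : ℂ)`
  (`qcdPhaseQuenchedExpect_eq_div_complex`, `qcdPhaseQuenchedExpect_eq_integral_qcdLatticeMeasure`,
  `integral_neg`, `integral_complex_ofReal`) and `⟨X⟩₊ ≤ |⟨X⟩₊| = ‖−(⟨X⟩₊ : ℂ)‖ ≤ Φ e^{-θ μ n}`.

Sources: I. Montvay, G. Münster, *Quantum Fields on a Lattice* (CUP 1994), §4.1.3 (4.25) (Wick rule),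
§5.1.2 (5.15) (γ₅-hermiticity); the template is `stub_pionSecondMomentDecay_of_crux`
(`…PionSecondMomentOfCrux.lean`), whose regularisation-indexed constants are replaced by the uniform ones.
-/

noncomputable section

namespace Summit.QuantumFields.QCD.Cruxes.PhaseQuenchedFlavourDecay.CrossingSplitIntegrability

open scoped BigOperators
open MeasureTheory Filter
open Literature.MathematicalPhysics.QuantumFieldTheory Literature.MathematicalPhysics.QuantumLattice
  Literature.Probability.LatticeModels

/-- **W (registered stub `stub_uniformPionSecondMoment_of_crux`).** NECESSITY made `(s, C)`-UNIFORM: the crux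
forces the `r = 1`, degenerate-doublet, `e₀`-axis slice of the uniform minor-moment decay.  For `m > 0`, a doublet
`f ≠ g` with `m f = m g` and Fredenhagen–Marcu data `(s, C)` there are `Φ`, `θ > 0`, `μ₀ > 0`, `Λ₀` such that at
EVERY lattice parameter point `(β, c, λ > 0)` (bare masses `c + λ m`), every rate `0 < μ ≤ μ₀`, every `L` with
`μ L ≥ Λ₀`: FM decay `≤ C e^{-μ‖v‖}` on volumes `S ≥ L` ⇒ `⟨Σ_{a,i,b,j}|G_f((0,a,i),(n e₀,b,j))|²⟩₊ ≤ Φ e^{-θ μ n}`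
on those volumes, `n ≤ S`.  Proof: `stub_uniformPencil_of_crux` applied to the flavoured pseudoscalar pair
(`pseudoscalarDensityObs Nf (Matrix.single g f 1)`, charge `+1` under `U(1)_f`), Wick identity `pionPair_fermiRatio_eq`. -/
theorem stub_uniformPionSecondMoment_of_crux :
    Summit.QuantumFields.QCD.Theses.PauliWegnerSea.PhaseQuenchedFlavourDecay →
      ∀ (Nf : ℕ) (m : Fin Nf → ℝ), (∀ f, 0 < m f) → ∀ (f g : Fin Nf), f ≠ g → m f = m g → ∀ (s C : ℝ), 0 < s → s < 1 →
        ∃ Φ θ μ₀ Λ₀ : ℝ, 0 < θ ∧ 0 < μ₀ ∧ ∀ (β c lam μ : ℝ) (L : ℕ), 0 < lam → 0 < μ → μ ≤ μ₀ → Λ₀ ≤ μ * L → (∀ S : ℕ, L ≤ S → ∀ (f : Fin Nf) (v : Literature.Probability.LatticeModels.Site 4), v ∈ box 4 S → (∫ U : GaugeConfig 4 (2 * S + 1) (Matrix.specialUnitaryGroup (Fin 3) ℂ), ‖(diracMatrix U fun fl => c + lam * m fl).det‖ * (∑ a : Fin 3, ∑ i : Fin 4, ∑ b : Fin 3, ∑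 j : Fin 4, ‖(diracMatrix U fun fl => c + lam * m fl)⁻¹ (quarkEquiv (f, (Torus.proj (2 * S + 1) 0, a, i))) (quarkEquiv (f, (Torus.proj (2 * S + 1) (v), b, j)))‖) ^ s ∂(wilsonMeasure (fundamentalRep (Fin 3)) β)) / (∫ U : GaugeConfig 4 (2 * S + 1) (Matrix.specialUnitaryGroup (Fin 3) ℂ), ‖(diracMatrix U fun fl => c + lam * m fl).det‖ ∂(wilsonMeasure (fundamentalRep (Fin 3)) β)) ≤ C * Real.exp (-(μ * ‖v‖))) → ∀ S : ℕ, L ≤ S → ∀ n : ℕ, n ≤ S → qcdPhaseQuenchedExpect β (2 * S + 1) (fun fl => c + lam * m fl) (fun U : GaugeConfig 4 (2 * S + 1) SU3 => ∑ a : Fin 3, ∑ i : Fin 4, ∑ b : Fin 3, ∑ j : Fin 4, ‖(diracMatrix U fun fl => c + lam * m fl)⁻¹ (quarkEquiv (f, (Torus.proj (2 * S + 1) 0, a, i))) (quarkEquiv (f, (Torus.proj (2 * S + 1) (Pi.single 0 (n : ℤ)), b, j)))‖ ^ (2 : ℕ)) ≤ Φ * Real.exp (-(θ * μ * n)) :=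 by
  intro hcrux Nf m hm f g hfg hfgm s C hs hs1
  obtain ⟨θ, hθ, hU⟩ := stub_uniformPencil_of_crux hcrux Nf m hm s C hs hs1
  obtain ⟨Φ, μ₀, Λ₀, hμ₀, hpt⟩ := hU 1 1 (pseudoscalarDensityObs Nf (Matrix.single g f 1))
    (pseudoscalarDensityObs Nf (Matrix.single f g 1))
    ⟨f, 1, one_ne_zero, isFlavourCharged_pseudoscalarDensityObs_single hfg⟩
  refine ⟨Φ, θ, μ₀, Λ₀, hθ, hμ₀, ?_⟩
  intro β c lam μ L hlam hμ hμle hΛ hFM S hS n hn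
  have key := hpt β c lam μ L hlam hμ hμle hΛ hFM S hS n hn
  set mq : Fin Nf → ℝ := fun fl => c + lam * m fl with hmqdef
  have hmq : mq f = mq g := by simp only [hmqdef, hfgm]
  have hwick : ∀ U : GaugeConfig 4 (2 * S + 1) SU3,
      fermiIntegral ((pseudoscalarDensityObs Nf (Matrix.single g f 1)).onTorus (2 * S + 1) 0 U *
            (pseudoscalarDensityObs Nf (Matrix.single f g 1)).onTorus (2 * S + 1)
              (Pi.single 0 (n : ℤ)) U *
          fermiBoltzmann U mq) / fermiIntegral (fermiBoltzmann U mq) =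
        -(((∑ a : Fin 3, ∑ i : Fin 4, ∑ b : Fin 3, ∑ j : Fin 4,
            ‖(diracMatrix U mq)⁻¹ (quarkEquiv (f, (Torus.proj (2 * S + 1) 0, a, i)))
              (quarkEquiv (f, (Torus.proj (2 * S + 1) (Pi.single 0 (n : ℤ)), b, j)))‖ ^ (2 : ℕ) : ℝ) :
            ℂ)) :=
    fun U => by
      rw [pseudoscalarDensityObs_single_onTorus, pseudoscalarDensityObs_single_onTorus]
      exact pionPair_fermiRatio_eq U mq hfg hmq _ _
  rw [← qcdPhaseQuenchedExpect_eq_div_complex, qcdPhaseQuenchedExpect_eq_integral_qcdLatticeMeasure] at key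
  simp only [hwick] at key
  rw [integral_neg, integral_complex_ofReal, norm_neg, Complex.norm_real, Real.norm_eq_abs] at key
  rw [qcdPhaseQuenchedExpect_eq_integral_qcdLatticeMeasure]
  exact (le_abs_self _).trans key

end Summit.QuantumFields.QCD.Cruxes.PhaseQuenchedFlavourDecay.CrossingSplitIntegrability
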